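import Summits.QuantumFields.BalabanUV.Beta.GAN24.AveragedPropagatorOneStepCubic
import Summits.QuantumFields.BalabanUV.Beta.GAN24.HardMinimiserOneStepSup
import Summits.QuantumFields.BalabanUV.T4Continuum.Support.BalabanHardMinimizer
import Summits.QuantumFields.BalabanUV.Beta.GAN24.AveragedPropagatorInverseUniform

/-!
# G-an2-4 ∕ (CONV-C), road P2, route R2-S1, VECTOR LAYER, PART 7 — THE INVERSE `(Q_k𝒢_kQ_k*)⁻¹` (the `H_k` denominator of [B5] (2.35);
# `= Δ_K + a`, NE2's `BalabanHardMinimizer.DeltaK`): its one-step sup law MODULO ONE interface item (V-SINV) = the n-uniform sup → sup bound of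
# `(Q𝒢Q*)⁻¹` itself; the second-resolvent identity transports Part 6's law

Unit `b2b-balaban-gan24-p2` (gen 30), BINDER row G-an2-4 ∕ (CONV-C), road P2; crux team (2).  `c_n = Q_n𝒢_nQ_n*` (`AveragedPropagatorTwoLevel.covOp`) is
uniformly COERCIVE (`AveragedPropagatorOneStepCubic.coercive_covOp`, NE2-P1's `γ_B(d,a)`), hence invertible at every level; by the second resolvent
identity (`HardMinimiserOneStepSup.inv_sub_inv`, gen 29) `c′⁻¹ − c⁻¹ = −c′⁻¹(c′ − c)c⁻¹`, so the one-step law of the inverse is Part 5∕6's law of `c`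
sandwiched between the sup → sup bounds `σ′`, `σ` of `c′⁻¹`, `c⁻¹` — DISPLAYED here; their n-UNIFORM supply at a = 1 is the interface item
«INTERFACE REQUEST G-an2-4: (V-SINV)» (`HOME/INBOX.md` 2026-08-21 l.7847, addressed to the swarm's Combes–Thomas road of leaf-03 gen 49):
 * §1 `isUnit_covOp_det` (every level, every torus, `a > 0`); **`covOp_inv_succ_sub`**: `(c_{RN})⁻¹ − (c_N)⁻¹ = −(c_{RN})⁻¹·(c_{RN} − c_N)·(c_N)⁻¹`;
 * §2 **`norm_covOp_inv_succ_sub_mulVec_le_of_sinv`** (every d, torus, a): given ANY one-step bound `|((c′ − c)f)(i)| ≤ K·|f|_∞` and the two binders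
   `|c⁻¹g| ≤ σ|g|`, `|c′⁻¹g| ≤ σ′|g|`: `|((c′⁻¹ − c⁻¹)g)(i)| ≤ σ′·K·σ·|g|_∞`;
 * §3 **`norm_covOp_inv_succ_sub_mulVec_le_cubic_of_sinv`** (a = 1, CUBIC): `∃ K(d) > 0, ∀ N R N₀ ≥ 1, ∀ σ σ′` (the two binders) `, |g| ≤ b →
   ‖(((c_{RN})⁻¹ − (c_N)⁻¹)g)(i)‖ ≤ K·((R−1)∕(RN))·(2 + log(RN) + log N)·σ′·σ·b` — Part 6 BY NAME; the moment (V-SINV) lands with `σ = σ′ = σ(d)`,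
   the inverse's law is unconditional (20-line plug);
 * §5 (v2 append) **`norm_covOp_inv_succ_sub_mulVec_le_cubic`**, **`norm_DeltaK_succ_sub_mulVec_le_cubic`** — (V-SINV) SUPPLIED by the swarm
   (`AveragedPropagatorInverseUniform.covOp_inv_sup_one_cubic`, leaf-03 gen 50): the inverse's ∕ `Δ_K`'s one-step sup law at `a = 1` on cubic tori,
   UNCONDITIONAL;
 * §4 the `Δ_K` reading: **`DeltaK_succ_sub_eq`** — NE2's effective operator `Δ_K = covB⁻¹ − a•1` (`BalabanHardMinimizer.DeltaK`) has
   `Δ_K^{(RN)} − Δ_K^{(N)} = (c_{RN})⁻¹ − (c_N)⁻¹` (the `a•1` cancels), so §2–§3 ARE its one-step sup law.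
HONEST SCOPE.  Junction (`obtain`, `inv_sub_inv`, triangle inequality); `U = 1`; the unconditional-modulo-(V-SINV) END is a = 1, CUBIC; sup currency;
the identification `Δ_K = Δ_k` of [B5] (1.65) is NE2's open dictionary step (needs (1.95) at the minimiser; `BalabanHardMinimizer` header) and is NOT
claimed.  [Balaban1984PropagatorsI] (1.65), (1.99), [Balaban1984PropagatorsII] (2.35) are TEXT LOCATIONS.  NOT (CONV-C) as typed, NEVER «G-an2-4 closed», NOT
NE2, NOT D1, NOT BetaPertH, NOT continuum, NOT Clay; not in print — our proof.  HONEST DEPENDENCY: continuum YM on T⁴ ⇐ BetaPertH ∧ nine spine estimates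
(0/9 proved); BetaPertH ⇐ (D1) ∧ (D4) ∧ CAP+tail; G-an2-4 gates asym, D1 and NE2/3/4.
-/

noncomputable section

open scoped BigOperators ComplexConjugate Matrix

namespace Summit.QuantumFields.BalabanUV.Beta.GAN24.AveragedPropagatorInverseOneStep

open Literature.MathematicalPhysics.QuantumFieldTheory.Balaban1983to89
open B5Prop11Plancherel (Tor fine)
open Summit.QuantumFields.BalabanUV.T4Continuum.CoerciveInverseTower (Coercive isUnit_of_coercive)
open Summit.QuantumFields.BalabanUV.T4Continuum.BalabanAveragedCoercive (gammaB gammaB_pos)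
open Summit.QuantumFields.BalabanUV.T4Continuum.BalabanHardMinimizer (DeltaK)
open Summit.QuantumFields.BalabanUV.Beta.GAN24.StaircaseAveragingDefect (ratio_nonneg)
open Summit.QuantumFields.BalabanUV.Beta.GAN24.AveragedPropagatorTwoLevel (covOp)
open Summit.QuantumFields.BalabanUV.Beta.GAN24.AveragedPropagatorOneStepCubic (covOp_eq_covB coercive_covOp norm_covOp_succ_sub_mulVec_le_cubic)
open Summit.QuantumFields.BalabanUV.Beta.GAN24.HardMinimiserOneStepSup (inv_sub_inv)

variable {d : ℕ}

/-! ## §1 Invertibility and the second resolvent identity -/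

section OneLevel

variable (n : ℕ) [NeZero n] (M : Fin d → ℕ) [hM : ∀ μ, NeZero (M μ)] {a : ℝ}

/-- `c_n(a)` is invertible for `a > 0` (uniform coercivity `coercive_covOp`). [folklore] -/
theorem isUnit_covOp_det (ha : 0 < a) : IsUnit (covOp n M a).det :=
  (Matrix.isUnit_iff_isUnit_det _).mp
    (isUnit_of_coercive (gammaB_pos (d := d) a ha) (coercive_covOp n (Nat.one_le_iff_ne_zero.mpr (NeZero.ne n)) M a ha))

end OneLevel

section TwoLevel

variable (N R : ℕ) [NeZero N] [NeZero R] (M : Fin d → ℕ) [hM : ∀ μ, NeZero (M μ)] {a : ℝ}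

/-- **`(c_{RN})⁻¹ − (c_N)⁻¹ = −(c_{RN})⁻¹·(c_{RN} − c_N)·(c_N)⁻¹`**. [folklore] -/
theorem covOp_inv_succ_sub (ha : 0 < a) :
    (covOp (R * N) M a)⁻¹ - (covOp N M a)⁻¹ = -((covOp (R * N) M a)⁻¹ * (covOp (R * N) M a - covOp N M a) * (covOp N M a)⁻¹) :=
  inv_sub_inv (isUnit_covOp_det (R * N) M ha) (isUnit_covOp_det N M ha)

/-! ## §2 The inverse's law from the direct law and the two binders -/

/-- **THE INVERSE's ONE-STEP SUP LAW, MODULO (V-SINV)** (every d, every torus, every a > 0): from any one-step sup bound `K` of `c_{RN} − c_N` and the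
two sup → sup binders `σ` (`c_N⁻¹`), `σ′` (`c_{RN}⁻¹`): `‖(((c_{RN})⁻¹ − (c_N)⁻¹)g)(i)‖ ≤ σ′·K·σ·|g|_∞`. [folklore] -/
theorem norm_covOp_inv_succ_sub_mulVec_le_of_sinv (ha : 0 < a) {K σ σ' : ℝ}
    (hrate : ∀ (f : Tor M × Fin d → ℂ) (b : ℝ), (∀ j, ‖f j‖ ≤ b) → ∀ i, ‖((covOp (R * N) M a - covOp N M a) *ᵥ f) i‖ ≤ K * b)
    (hS : ∀ (f : Tor M × Fin d → ℂ) (b : ℝ), (∀ j, ‖f j‖ ≤ b) → ∀ i, ‖((covOp N M a)⁻¹ *ᵥ f) i‖ ≤ σ * b)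
    (hS' : ∀ (f : Tor M × Fin d → ℂ) (b : ℝ), (∀ j, ‖f j‖ ≤ b) → ∀ i, ‖((covOp (R * N) M a)⁻¹ *ᵥ f) i‖ ≤ σ' * b)
    (g : Tor M × Fin d → ℂ) (b : ℝ) (hg : ∀ j, ‖g j‖ ≤ b) (i : Tor M × Fin d) :
    ‖(((covOp (R * N) M a)⁻¹ - (covOp N M a)⁻¹) *ᵥ g) i‖ ≤ σ' * (K * (σ * b)) := by
  rw [covOp_inv_succ_sub N R M ha, Matrix.neg_mulVec, Pi.neg_apply, norm_neg, ← Matrix.mulVec_mulVec, ← Matrix.mulVec_mulVec]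
  exact hS' _ _ (hrate _ _ (hS g b hg)) i

/-! ## §3 At `a = 1` on cubic tori: Part 6 BY NAME -/

/-- **THE INVERSE's ONE-STEP SUP LAW ON CUBIC TORI AT `a = 1`, MODULO (V-SINV) ONLY**: `∃ K(d) > 0` such that for all `N, R, N₀ ≥ 1`, all sup → sup
bounds `σ, σ′` of `(c_N)⁻¹, (c_{RN})⁻¹` and all `|g| ≤ b`:
`‖(((c_{RN})⁻¹ − (c_N)⁻¹)g)(i)‖ ≤ K·((R−1)∕(RN))·(2 + log(RN) + log N)·σ′·σ·b`. [folklore] -/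
theorem norm_covOp_inv_succ_sub_mulVec_le_cubic_of_sinv (d : ℕ) :
    ∃ K : ℝ, 0 < K ∧ ∀ (N R N₀ : ℕ) [NeZero N] [NeZero R] [NeZero N₀] (σ σ' : ℝ),
      (∀ (f : Tor (fun _ : Fin (d + 1) => N₀) × Fin (d + 1) → ℂ) (b : ℝ), (∀ j, ‖f j‖ ≤ b) →
        ∀ i, ‖((covOp N (fun _ : Fin (d + 1) => N₀) 1)⁻¹ *ᵥ f) i‖ ≤ σ * b) →
      (∀ (f : Tor (fun _ : Fin (d + 1) => N₀) × Fin (d + 1) → ℂ) (b : ℝ), (∀ j, ‖f j‖ ≤ b) →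
        ∀ i, ‖((covOp (R * N) (fun _ : Fin (d + 1) => N₀) 1)⁻¹ *ᵥ f) i‖ ≤ σ' * b) →
      ∀ (g : Tor (fun _ : Fin (d + 1) => N₀) × Fin (d + 1) → ℂ) (b : ℝ), (∀ j, ‖g j‖ ≤ b) →
        ∀ i, ‖(((covOp (R * N) (fun _ : Fin (d + 1) => N₀) 1)⁻¹ - (covOp N (fun _ : Fin (d + 1) => N₀) 1)⁻¹) *ᵥ g) i‖
          ≤ K * (((R : ℝ) - 1) / ((R : ℝ) * N)) * (2 + Real.log ((R * N : ℕ) : ℝ) + Real.log (N : ℝ)) * σ' * σ * b := by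
  obtain ⟨K, hK, h⟩ := norm_covOp_succ_sub_mulVec_le_cubic d
  refine ⟨K, hK, fun N R N₀ _ _ _ σ σ' hS hS' g b hg i => ?_⟩
  have key := norm_covOp_inv_succ_sub_mulVec_le_of_sinv N R (fun _ : Fin (d + 1) => N₀) one_pos
    (K := K * (((R : ℝ) - 1) / ((R : ℝ) * N)) * (2 + Real.log ((R * N : ℕ) : ℝ) + Real.log (N : ℝ)))
    (fun f b' hf j => by have := h N R N₀ f b' hf j; linarith) hS hS' g b hg i
  calc _ ≤ _ := key
    _ = _ := by ring

/-! ## §4 The `Δ_K` reading -/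

/-- **NE2's effective operator steps like the inverse**: `Δ_K^{(RN)} − Δ_K^{(N)} = (c_{RN})⁻¹ − (c_N)⁻¹` (`Δ_K = covB⁻¹ − a•1`, `covB = covOp`; the
`a•1` cancels) — so §2–§3 are the one-step sup law of `BalabanHardMinimizer.DeltaK` verbatim. [folklore] -/
theorem DeltaK_succ_sub_eq (ha : 0 < a) (hN : 1 ≤ N) (hRN : 1 ≤ R * N) :
    DeltaK (R * N) hRN M a ha - DeltaK N hN M a ha = (covOp (R * N) M a)⁻¹ - (covOp N M a)⁻¹ := by
  rw [DeltaK, DeltaK, ← covOp_eq_covB (R * N) hRN M a ha, ← covOp_eq_covB N hN M a ha]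
  abel

end TwoLevel

/-! ## §5 (V-SINV) SUPPLIED — the inverse's law on cubic tori at `a = 1` with NO displayed binder (v2 append, gen 30)

The two binders `σ, σ′` of §3 are the content of «INTERFACE REQUEST G-an2-4: (V-SINV)» (INBOX 2026-08-21 l.7847), DELIVERED within the hour by
the swarm's leaf-03 gen 50: `AveragedPropagatorInverseUniform.covOp_inv_sup_one_cubic` (p265411; `σ(d)` for every `n ≥ 1`, every cubic torus — in
fact every torus and every `a > 0`, with a KERNEL form, via the Literature lane's `B6Cov2156TorusDelK`).  Composing BY NAME: -/

section Supplied

open Summit.QuantumFields.BalabanUV.Beta.GAN24.AveragedPropagatorInverseUniform (covOp_inv_sup_one_cubic)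

/-- **THE ONE-STEP SUP LAW OF `(Q_k𝒢_kQ_k*)⁻¹` AT `U = 1`, `a = 1`, ON EVERY CUBIC UNIT TORUS — UNCONDITIONAL**: `∃ K(d) > 0` such that for all
`N, R, N₀ ≥ 1`, every `|g| ≤ b` and every unit bond `i`,
`‖(((c_{RN})⁻¹ − (c_N)⁻¹)g)(i)‖ ≤ K·((R−1)∕(RN))·(2 + log(RN) + log N)·b` (`c_n = covOp n T 1`). [folklore] -/
theorem norm_covOp_inv_succ_sub_mulVec_le_cubic (d : ℕ) :
    ∃ K : ℝ, 0 < K ∧ ∀ (N R N₀ : ℕ) [NeZero N] [NeZero R] [NeZero N₀]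
      (g : Tor (fun _ : Fin (d + 1) => N₀) × Fin (d + 1) → ℂ) (b : ℝ), (∀ j, ‖g j‖ ≤ b) →
        ∀ i : Tor (fun _ : Fin (d + 1) => N₀) × Fin (d + 1),
          ‖(((covOp (R * N) (fun _ : Fin (d + 1) => N₀) 1)⁻¹ - (covOp N (fun _ : Fin (d + 1) => N₀) 1)⁻¹) *ᵥ g) i‖
            ≤ K * (((R : ℝ) - 1) / ((R : ℝ) * N)) * (2 + Real.log ((R * N : ℕ) : ℝ) + Real.log (N : ℝ)) * b := by
  obtain ⟨K, hK, h⟩ := norm_covOp_inv_succ_sub_mulVec_le_cubic_of_sinv d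
  obtain ⟨σ, hσ, hS⟩ := covOp_inv_sup_one_cubic (d := d)
  refine ⟨K * σ * σ, by positivity, fun N R N₀ _ _ _ g b hg i => ?_⟩
  have hN : 1 ≤ N := Nat.one_le_iff_ne_zero.mpr (NeZero.ne N)
  have hRN : 1 ≤ R * N := Nat.one_le_iff_ne_zero.mpr (NeZero.ne (R * N))
  have key := h N R N₀ σ σ (fun f b' hf j => hS N N₀ hN f b' hf j) (fun f b' hf j => hS (R * N) N₀ hRN f b' hf j) g b hg i
  calc _ ≤ _ := key
    _ = _ := by ring

/-- **THE SAME LAW FOR NE2's EFFECTIVE OPERATOR `Δ_K = covB⁻¹ − a•1`** (`BalabanHardMinimizer.DeltaK`; `DeltaK_succ_sub_eq`), at `a = 1` on cubic tori,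
UNCONDITIONAL. [folklore] -/
theorem norm_DeltaK_succ_sub_mulVec_le_cubic (d : ℕ) :
    ∃ K : ℝ, 0 < K ∧ ∀ (N R N₀ : ℕ) [NeZero N] [NeZero R] [NeZero N₀] (hN : 1 ≤ N) (hRN : 1 ≤ R * N)
      (g : Tor (fun _ : Fin (d + 1) => N₀) × Fin (d + 1) → ℂ) (b : ℝ), (∀ j, ‖g j‖ ≤ b) →
        ∀ i : Tor (fun _ : Fin (d + 1) => N₀) × Fin (d + 1),
          ‖((DeltaK (R * N) hRN (fun _ : Fin (d + 1) => N₀) 1 one_pos - DeltaK N hN (fun _ : Fin (d + 1) => N₀) 1 one_pos) *ᵥ g) i‖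
            ≤ K * (((R : ℝ) - 1) / ((R : ℝ) * N)) * (2 + Real.log ((R * N : ℕ) : ℝ) + Real.log (N : ℝ)) * b := by
  obtain ⟨K, hK, h⟩ := norm_covOp_inv_succ_sub_mulVec_le_cubic d
  refine ⟨K, hK, fun N R N₀ _ _ _ hN hRN g b hg i => ?_⟩
  rw [DeltaK_succ_sub_eq N R (fun _ : Fin (d + 1) => N₀) one_pos hN hRN]
  exact h N R N₀ g b hg i

end Supplied

end Summit.QuantumFields.BalabanUV.Beta.GAN24.AveragedPropagatorInverseOneStep

end
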